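import Literature.NumberTheory.Automorphic.Liu2021.Def45Polarisation
import Mathlib.RingTheory.TensorProduct.Free
import Mathlib.RingTheory.Trace.Basic
import HarnessLib

/-!
# [Liu 2021] Definition 4.5 (2), fourth bullet — the de Rham trivialisation `r_μ`, typed REAL on orbits of `H¹`

Y. Liu, *Fourier–Jacobi cycles and arithmetic relative trace formula*, Camb. J. Math. **9** (2021) = arXiv:2102.11518
[Liu2021]; TeX source `FJcycle.tex` (md5 `6db49a74122d…`), §4.1, Definition 4.5 (2) fourth bullet (l. 1957) and the
proof of Prop. 4.6 (1), l. 1982 «The existence of `r_μ` is obvious».  Sub-row (CP-S4c-P) r-half of the pub-hodgecm2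
team table `HOME/pinning/HCMISOG-TABLE.md`; red-team WATCH W1, r-half (hodge-director/TGTBT.md D18.3, D22.3 item 1).

AS PRINTED (l. 1957), VERBATIM: «• `r_μ : M_μ ⊗_ℚ E → H_1^{dR}(A_μ/E)` is an isomorphism of `M_μ ⊗_ℚ E`-modules satisfying
that there exist an element `β ∈ M_μ` and an isomorphism `c : H^{dR}_{2 dim A_μ}(A_μ/E) → E` of `E`-modules, such that
for every `x, y ∈ M_μ ⊗_ℚ E`, we have `c(⟨r_μ(x), r_μ(y)⟩_λ) = Tr_{M_μ ⊗_ℚ E/E}(x β ȳ)`, where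
`⟨ , ⟩_λ : H_1^{dR}(A_μ/E) × H_1^{dR}(A_μ/E) → H^{dR}_{2 dim A_μ}(A_μ/E)` denotes the pairing induced by `λ`».

## What this file does (definitions + unfolding lemmas; no named fact; nothing about `H_1^{dR}` is constructed)

Up to now the fourth bullet is the ⟨CARRIER⟩ token `R : ∀ A, (M_μ →+* End⁰ A) → Type` of `Def45.PolDR σ hμ R`
(`Def45Polarisation.lean`), displayed with `hR : ∀ A i, Nonempty (R A i)` in the cells' END displays; `R := PUnit`
elaborates (pub-hodgecm htheta-x2's vacuity note), so the token restricts nothing by type.  The tree has no algebraic de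
Rham (co)homology over a number field, so `r_μ` itself cannot be named.  What CAN be named is the CONTENT of the bullet
on every candidate `E`-structure: after the comparison isomorphism `H^1_{dR}(A_μ/E) ⊗_{E,σ} ℂ ≅ H¹(A_μ ⊗_{E,σ} ℂ (ℂ); ℂ)`
[Grothendieck 1966] the de Rham `E`-structure is ONE `E ⊗_ℚ M_μ`-orbit `(E ⊗ M_μ) · w₀` inside the tree's carrier
`H := complexBetti (A ⊗_σ ℂ).X 1` — the action `actL` of `L = E ⊗_ℚ M_μ` (the tree's scalar-left orientation of
`M_μ ⊗_ℚ E`) being `f ⊗ m ↦ σ(f) · i(m)^*` with `i(m)^* = ComplexMultiplication.complexAction` — on which the polarisation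
pairing `Q_{θ₂} = θ₂^{dim-1} ⌣ (· ⌣ ·)` (`Motives.polarizationPairingOne`, the cohomological shadow of `⟨ , ⟩_λ` already used
for bullet 3 in `Def45.IsPolarisationClass`) is `E`-valued and perfect through the de Rham trace `c₀ : H^{2 dim}(ℂ) → ℂ`
(compatibility of the comparison with cup product, cycle classes and traces, [Deligne 1982, §1]).  READING P-R2 (this
file): ask the printed normalisation on EVERY such orbit.

* §1 `Def45.actL A i : k ⊗_ℚ K → End_ℂ H¹(A_ℂ(ℂ); ℂ)` — the action `f ⊗ m ↦ σ(f) · i(m)^*` (written on the `k`-basis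
  `1 ⊗ b_j` of `k ⊗_ℚ K`, `b = Module.finBasis ℚ K`, to avoid a `ℚ`-structure on `End_ℂ`); §1 proves it is the
  `k`-algebra action: `actL_tmul`, `actL_add`, `actL_smul`, `actL_one`, `actL_mul`.
* §2 `Def45.IsRMuNormalisable τ₀ A i θ₂` — **the fourth bullet typed REAL**: for every `ρ : K → K` inducing complex
  conjugation along `τ₀`, every `w₀ ∈ H` and every `ℂ`-linear `c₀ : H^{2+2(dim-1)}(A_ℂ(ℂ); ℂ) → ℂ` such that
  (R) `c₀ Q_{θ₂}(x · w₀, y · w₀) ∈ σ(k)` for all `x, y ∈ k ⊗ K` (the pairing is `k`-valued on the orbit) and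
  (P) `x · w₀ ⊥ (k ⊗ K) · w₀` through `c₀ Q_{θ₂}` only for `x = 0` (it is perfect there — this forces the orbit map
  `x ↦ x · w₀` to be injective, i.e. print's «isomorphism of `M_μ ⊗_ℚ E`-modules» onto the orbit),
  THERE ARE a unit `a ∈ (k ⊗ K)^×` (print's `r_μ := x ↦ (x a) · w₀`, another generator of the same orbit), `β ∈ K` and
  `e ∈ k`, `e ≠ 0` (print's `c := e⁻¹ · c₀`) with `c₀ Q_{θ₂}((x a) · w₀, (y a) · w₀) = σ(e · Tr_{k ⊗ K/k}(x (1 ⊗ β) ȳ))` for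
  all `x, y`, `ȳ = (1 ⊗ ρ) y` — the printed identity.
* §2 `Def45.RMuForm σ hμ : ∀ A, (M_μ →+* End⁰ A) → Type` — the carrier of `PolDR`'s `R`-shape:
  `PLift (∀ θ₂, IsPolarisationClass (M_μ ⊆ ℂ) A i θ₂ → IsRMuNormalisable (M_μ ⊆ ℂ) A i θ₂)`, so that
  `Def45.PolDR σ hμ (RMuForm σ hμ) A i = {θ₂ // bullet 3} × PLift (bullet 3 ⇒ bullet 4 on every admissible orbit)`.
  Consumers keep their slots: `R := fun F _ ι₁ V Φ => Def45.RMuForm ι₁ (isConjugateSymplectic_muOfInvType ι₁ Φ)`.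
* §3 unfolding lemmas (`Iff.rfl` level): `nonempty_rMuForm_iff`, `nonempty_polDR_rMuForm_iff`.

CLASS OF THE READING (for the red team).  (1) Liu states bullet 4 on `H_1^{dR}`; it is read here on `H¹ = (H_1)^∨`
(the tree's carrier is cohomology; the dual of a trace-form-normalised free `M_μ ⊗ E`-line is again one) — the same move
as bullet 3's READING P-R1 («Rosati read on `H¹`»).  (2) As a restriction on objects the predicate is ≥ print: it asks
the normalisation on EVERY admissible orbit, print asks it on the de Rham one, which is admissible by the cite-level
sentences above ((i) rank-one freeness = comparison + CM type, (ii) `E`-valued perfect pairing = comparison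
compatibilities) — so an object `(A, i, θ₂, _)` over `PolDR σ hμ (RMuForm σ hμ)` is a Liu datum's image and citing
[Liu21] Thm. 4.18 at it is NOT a scope widening.  (3) It is PROVABLE for every `(A, i, θ₂)` satisfying bullet 3 at every
face of a GALOIS CM field, from hcmisog-isog-2's engine `Liu2021/Def45RMuExists` (`r_μ` exists for every abstract de Rham
datum; general-algebra layer of record b25's `CorCM/RMuNorm*`): sequel `Liu2021/Def45RMuFormSupply`; with it `hR` is a
THEOREM and the END display posits no CM-side token.  (4) Nothing here constructs `H_1^{dR}(A_μ/E)`, Liu's `X_K`, `A_K`,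
`Ω(μ)`, or touches `hM`; HC_CM is NOT proved.

References: [Liu2021] Y. Liu, Camb. J. Math. 9 (2021) = arXiv:2102.11518 — §4.1 l. 1928 (`M_μ ⊆ ℂ`), Def. 4.5 (2) fourth
bullet (TeX l. 1957), proof of Prop. 4.6 (1) (l. 1982); [Grothendieck1966deRham] A. Grothendieck, *On the de Rham
cohomology of algebraic varieties*, Publ. Math. IHÉS 29 (1966), Thm. 1′; [Deligne1982HodgeCycles] P. Deligne, *Hodge cycles
on abelian varieties*, LNM 900 (1982), §1; [Shimura1998] G. Shimura, *Abelian Varieties with Complex Multiplication and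
Modular Functions* (1998), §5.2 (the representation of `ι(K)` on `H¹`), §6.2 Thm. 4 («`E(v(α), v(β)) = Tr_{K/ℚ}(ζαβ^ρ)`»).
-/

set_option autoImplicit false

noncomputable section

open scoped TensorProduct NumberField ComplexConjugate
open CategoryTheory NumberField
open Literature.AlgebraicGeometry.Motives Literature.AlgebraicGeometry.HodgeTheory
open Literature.AlgebraicGeometry.ComplexMultiplication
open Literature.NumberTheory.ComplexMultiplication
open Literature.NumberTheory.GaloisRepresentations
open Literature.AlgebraicTopology.SingularHomology

namespace Literature.NumberTheory.Automorphic.Liu2021.Def45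

/-! ## §1 The action of `L = k ⊗_ℚ K` on `H¹(A_ℂ(ℂ); ℂ)` -/

section RatAction

variable {B : AbelianVariety ℂ} {K : Type} [Field K] [NumberField K] (φ : K →+* B.endAlgebra)

/-- The complexified rational action is `ℚ`-linear: `i(q)^* = q · id` on `H¹(B(ℂ); ℂ)` for `q ∈ ℚ`
(`i(n)^* = n`, clear the denominator). [cite: Shimura1998, §5.2] -/
theorem complexAction_ratCast_apply (q : ℚ) (v : complexBetti B.X 1) :
    complexAction φ (q : K) v = (q : ℂ) • v := by
  have hden : (q.den : ℂ) ≠ 0 := Nat.cast_ne_zero.mpr q.den_ne_zero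
  have hnat : ∀ (n : ℕ) (u : complexBetti B.X 1), complexAction φ (n : K) u = (n : ℂ) • u := fun n u => by
    rw [map_natCast, Module.End.natCast_apply, Nat.cast_smul_eq_nsmul]
  have hint : ∀ (z : ℤ) (u : complexBetti B.X 1), complexAction φ (z : K) u = (z : ℂ) • u := fun z u => by
    rw [map_intCast, Module.End.intCast_apply, Int.cast_smul_eq_zsmul]
  have hq : (q : K) * (q.den : K) = (q.num : K) := by
    rw [← Rat.cast_natCast, ← Rat.cast_mul, Rat.mul_den_eq_num, Rat.cast_intCast]
  have key : (q.den : ℂ) • complexAction φ (q : K) v = (q.num : ℂ) • v := by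
    rw [← LinearMap.map_smul, ← hnat, ← Module.End.mul_apply, ← map_mul, hq, hint]
  have hq' : (q : ℂ) = (q.num : ℂ) / (q.den : ℂ) := by rw [Rat.cast_def]
  rw [hq', div_eq_inv_mul, mul_smul, ← key, smul_smul, inv_mul_cancel₀ hden, one_smul]

/-- `i(q m)^* = q · i(m)^*` for `q ∈ ℚ`. [cite: Shimura1998, §5.2] -/
theorem complexAction_rat_smul (q : ℚ) (m : K) :
    complexAction φ (q • m) = (q : ℂ) • complexAction φ m := by
  refine LinearMap.ext fun v => ?_
  rw [Rat.smul_def, map_mul, Module.End.mul_apply, complexAction_ratCast_apply, LinearMap.smul_apply]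

end RatAction

section Action

variable {k : Type} [Field k] [NumberField k] [Algebra k ℂ] {K : Type} [Field K] [NumberField K]

/-- **The action of `L = k ⊗_ℚ K` on `H¹(A_ℂ(ℂ); ℂ)`**, `A_ℂ = A ⊗_k ℂ`: `f ⊗ m ↦ σ(f) · i(m)^*` (`σ = algebraMap k ℂ`,
`i(m)^* = complexAction (i ⊗ ℂ) m`, [Shimura1998] §5.2), written in the coordinates of the `k`-basis `1 ⊗ b_j` of
`k ⊗_ℚ K` (`b = Module.finBasis ℚ K`, Mathlib `Algebra.TensorProduct.basis`): `actL x = Σ_j σ(x_j) · i(b_j)^*`.  For Liu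
(`k = E`, `K = M_μ`) this is the `M_μ ⊗_ℚ E`-module structure in which `r_μ` is «an isomorphism of `M_μ ⊗_ℚ E`-modules»
(l. 1957), read on `H¹`. [cite: Liu2021, Def. 4.5 (2) fourth bullet (TeX l. 1957)] [cite: Shimura1998, §5.2] -/
def actL (A : AbelianVariety k) (i : K →+* A.endAlgebra) (x : k ⊗[ℚ] K) :
    Module.End ℂ (complexBetti (A.baseChange ℂ).X 1) :=
  ∑ j, algebraMap k ℂ ((Algebra.TensorProduct.basis k (Module.finBasis ℚ K)).repr x j) •
    complexAction ((AbelianVariety.endAlgebraBaseChange ℂ A).toRingHom.comp i) (Module.finBasis ℚ K j)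

variable (A : AbelianVariety k) (i : K →+* A.endAlgebra)

/-- `actL` is additive. [cite: Liu2021, Def. 4.5 (2) fourth bullet (TeX l. 1957)] -/
theorem actL_add (x y : k ⊗[ℚ] K) : actL A i (x + y) = actL A i x + actL A i y := by
  simp only [actL, map_add, Finsupp.add_apply, add_smul, Finset.sum_add_distrib]

/-- `actL` is `k`-linear through `σ = algebraMap k ℂ`. [cite: Liu2021, Def. 4.5 (2) fourth bullet (TeX l. 1957)] -/
theorem actL_smul (f : k) (x : k ⊗[ℚ] K) : actL A i (f • x) = algebraMap k ℂ f • actL A i x := by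
  simp only [actL, map_smul, Finsupp.smul_apply, smul_eq_mul, map_mul, mul_smul, Finset.smul_sum]

/-- `actL 0 = 0`. [cite: Liu2021, Def. 4.5 (2) fourth bullet (TeX l. 1957)] -/
theorem actL_zero : actL A i 0 = 0 := by
  simp only [actL, map_zero, Finsupp.zero_apply, zero_smul, Finset.sum_const_zero]

/-- **`actL (f ⊗ m) = σ(f) · i(m)^*`** — the defining formula on pure tensors (so `actL` is THE action, independent of
the basis used to write it). [cite: Liu2021, Def. 4.5 (2) fourth bullet (TeX l. 1957)] [cite: Shimura1998, §5.2] -/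
theorem actL_tmul (f : k) (m : K) :
    actL A i (f ⊗ₜ[ℚ] m) =
      algebraMap k ℂ f • complexAction ((AbelianVariety.endAlgebraBaseChange ℂ A).toRingHom.comp i) m := by
  classical
  set φ := (AbelianVariety.endAlgebraBaseChange ℂ A).toRingHom.comp i with hφ
  set b := Module.finBasis ℚ K with hb
  have hcoord : ∀ j, (Algebra.TensorProduct.basis k b).repr (f ⊗ₜ[ℚ] m) j = f * algebraMap ℚ k (b.repr m j) := by
    intro j
    rw [Algebra.TensorProduct.basis_repr_tmul, Finsupp.smul_apply, Finsupp.mapRange_apply, smul_eq_mul]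
  have hm : complexAction φ m = ∑ j, ((b.repr m j : ℚ) : ℂ) • complexAction φ (b j) := by
    conv_lhs => rw [← b.sum_repr m]
    rw [map_sum]
    refine Finset.sum_congr rfl fun j _ => ?_
    rw [complexAction_rat_smul]
  have hstep : ∀ j, algebraMap k ℂ ((Algebra.TensorProduct.basis k b).repr (f ⊗ₜ[ℚ] m) j) • complexAction φ (b j) =
      algebraMap k ℂ f • (((b.repr m j : ℚ) : ℂ) • complexAction φ (b j)) := fun j => by
    rw [hcoord, map_mul, mul_smul, ← IsScalarTower.algebraMap_apply ℚ k ℂ, eq_ratCast]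
  unfold actL
  rw [← hb, ← hφ, Finset.sum_congr rfl fun j _ => hstep j, ← Finset.smul_sum, ← hm]

/-- `actL 1 = id`. [cite: Liu2021, Def. 4.5 (2) fourth bullet (TeX l. 1957)] -/
theorem actL_one : actL A i 1 = 1 := by
  rw [Algebra.TensorProduct.one_def, actL_tmul, map_one, map_one, one_smul]

/-- **`actL` is multiplicative**: `(x y) · v = x · (y · v)` — `H¹` is a `k ⊗_ℚ K`-module through `actL`.
[cite: Liu2021, Def. 4.5 (2) fourth bullet (TeX l. 1957)] [cite: Shimura1998, §5.2] -/
theorem actL_mul (x y : k ⊗[ℚ] K) : actL A i (x * y) = actL A i x * actL A i y := by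
  induction x using TensorProduct.induction_on with
  | zero => rw [zero_mul, actL_zero, zero_mul]
  | tmul f m =>
    induction y using TensorProduct.induction_on with
    | zero => rw [mul_zero, actL_zero, mul_zero]
    | tmul f' m' =>
      rw [Algebra.TensorProduct.tmul_mul_tmul, actL_tmul, actL_tmul, actL_tmul, map_mul, map_mul, smul_mul_smul_comm]
    | add y₁ y₂ h₁ h₂ => rw [mul_add, actL_add, actL_add, h₁, h₂, mul_add]
  | add x₁ x₂ h₁ h₂ => rw [add_mul, actL_add, actL_add, h₁, h₂, add_mul]

/-- Pure `K`-elements act by `i(m)^*`: `actL (1 ⊗ m) = i(m)^*`. [cite: Shimura1998, §5.2] -/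
theorem actL_one_tmul (m : K) :
    actL A i ((1 : k) ⊗ₜ[ℚ] m) = complexAction ((AbelianVariety.endAlgebraBaseChange ℂ A).toRingHom.comp i) m := by
  rw [actL_tmul, map_one, one_smul]

end Action

/-! ## §2 The fourth bullet of Def. 4.5 (2), typed REAL on orbits of `H¹`; the carrier `RMuForm` -/

section Predicate

variable {k : Type} [Field k] [NumberField k] [Algebra k ℂ] {K : Type} [Field K] [NumberField K]

/-- **[Liu2021, Def. 4.5 (2)] FOURTH BULLET (l. 1957), typed REAL** (READING P-R2 of the module docstring) as a
predicate on `(A/k, i : K → End⁰(A), θ₂ ∈ H²(A_ℂ(ℂ); ℚ))` along `τ₀ : K → ℂ`, with `L = k ⊗_ℚ K` acting on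
`H = H¹(A_ℂ(ℂ); ℂ)` by `actL` (`x · v`), `Q = Q_{θ₂} = polarizationPairingOne _ (θ₂ ⊗ 1) (dim - 1)` and `σ = algebraMap k ℂ`:
for every `ρ : K → K` with `τ₀ ∘ ρ = conj ∘ τ₀` (complex conjugation of `M_μ ⊆ ℂ`, l. 1928), every `w₀ ∈ H` and every
`ℂ`-linear functional `c₀` on `H^{2+2(dim A_ℂ-1)}(A_ℂ(ℂ); ℂ)` such that
(R) `c₀ Q(x · w₀, y · w₀) ∈ σ(k)` for all `x, y ∈ L` — the pairing is `k`-valued on the orbit `L · w₀` — and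
(P) for `x ∈ L`, `c₀ Q(x · w₀, y · w₀) = 0` for all `y ∈ L` only if `x = 0` — it is perfect there (hence `x ↦ x · w₀` is
injective: the orbit is free of rank one and print's `r_μ` «an isomorphism of `M_μ ⊗_ℚ E`-modules» onto it),
THERE EXIST a unit `a ∈ L` (print's `r_μ := x ↦ (x a) · w₀`), `β ∈ K` and `e ∈ k`, `e ≠ 0` (print's `c := e⁻¹ · c₀`) with,
for all `x, y ∈ L`: `c₀ Q((x a) · w₀, (y a) · w₀) = σ(e · Tr_{L/k}(x · (1 ⊗ β) · ȳ))`, `ȳ = (1 ⊗ ρ) y` — the printed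
`c(⟨r_μ(x), r_μ(y)⟩_λ) = Tr_{M_μ ⊗_ℚ E/E}(x β ȳ)`.  DEFINED; supplied at Galois faces by `Liu2021/Def45RMuFormSupply`.
[cite: Liu2021, Def. 4.5 (2) fourth bullet (TeX l. 1957) and proof of Prop. 4.6 (1) (l. 1982)]
[cite: Shimura1998, §5.2 and §6.2 Theorem 4] -/
def IsRMuNormalisable (τ₀ : K →+* ℂ) (A : AbelianVariety k) (i : K →+* A.endAlgebra)
    (θ₂ : bettiCohomology (A.baseChange ℂ).X 2) : Prop :=
  ∀ ρ : K →+* K, (∀ x, τ₀ (ρ x) = conj (τ₀ x)) →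
  ∀ (w₀ : complexBetti (A.baseChange ℂ).X 1)
    (c₀ : complexBetti (A.baseChange ℂ).X (2 + 2 * ((A.baseChange ℂ).dim - 1)) →ₗ[ℂ] ℂ),
    (∀ x y : k ⊗[ℚ] K,
      c₀ (polarizationPairingOne (A.baseChange ℂ).X (ofRatClass (ComplexPoints (A.baseChange ℂ).X) 2 θ₂)
          ((A.baseChange ℂ).dim - 1) (actL A i x w₀) (actL A i y w₀)) ∈ Set.range (algebraMap k ℂ)) →
    (∀ x : k ⊗[ℚ] K,
      (∀ y : k ⊗[ℚ] K,
        c₀ (polarizationPairingOne (A.baseChange ℂ).X (ofRatClass (ComplexPoints (A.baseChange ℂ).X) 2 θ₂)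
            ((A.baseChange ℂ).dim - 1) (actL A i x w₀) (actL A i y w₀)) = 0) → x = 0) →
    ∃ (a : k ⊗[ℚ] K) (β : K) (e : k), IsUnit a ∧ e ≠ 0 ∧
      ∀ x y : k ⊗[ℚ] K,
        c₀ (polarizationPairingOne (A.baseChange ℂ).X (ofRatClass (ComplexPoints (A.baseChange ℂ).X) 2 θ₂)
            ((A.baseChange ℂ).dim - 1) (actL A i (x * a) w₀) (actL A i (y * a) w₀)) =
          algebraMap k ℂ (e * Algebra.trace k (k ⊗[ℚ] K)
            (x * ((1 : k) ⊗ₜ[ℚ] β) * Algebra.TensorProduct.map (AlgHom.id k k) ρ.toRatAlgHom y))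

end Predicate

section Carrier

variable {F : Type} [Field F] [NumberField F] [IsCMField F] (σ : F →+* ℂ)
  {μ : IdeleClassGroup F →ₜ* Circle} (hμ : IdeleClassGroup.IsConjugateSymplectic F μ)

/-- **The `r_μ`-carrier of `PolDR`'s `R`-shape with BULLET 4 REAL**: over the pin `σ : F → ℂ` (Liu's `E ⊆ ℂ`), for
`(A, i)`, the type `PLift (∀ θ₂, IsPolarisationClass (M_μ ⊆ ℂ) A i θ₂ → IsRMuNormalisable (M_μ ⊆ ℂ) A i θ₂)`: for every
polarisation class satisfying bullet 3 (l. 1955) along the inclusion `M_μ ⊆ ℂ` (so `ρ` IS complex conjugation on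
`M_μ ⊆ ℂ`, l. 1928), the printed `r_μ`-normalisation (l. 1957) holds on every admissible `E ⊗ M_μ`-orbit of
`H¹(A ⊗_{F,σ} ℂ (ℂ); ℂ)`.  Use: `Carriers.ofPolDR μ (PolDR σ hμ (RMuForm σ hμ))` — then an object carries `θ₂` with
bullet 3 AND the bullet-4 normalisation statement at that `θ₂`.  DEFINED (inhabited at every face of a Galois CM field,
`Liu2021/Def45RMuFormSupply`). [cite: Liu2021, Def. 4.5 (2) (TeX ll. 1955–1957)] -/
def RMuForm (A : AbelianVariety F) (i : IdeleClassGroup.muAlgValueField F μ →+* A.endAlgebra) : Type :=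
  letI : Algebra F ℂ := σ.toAlgebra
  haveI := hμ.numberField_muAlgValueField
  PLift (∀ θ₂ : bettiCohomology (A.baseChange ℂ).X 2,
    IsPolarisationClass (IdeleClassGroup.muAlgValueField F μ).subtype A i θ₂ →
      IsRMuNormalisable (IdeleClassGroup.muAlgValueField F μ).subtype A i θ₂)

end Carrier

/-! ## §3 Unfolding lemmas -/

section Unfolding

variable {F : Type} [Field F] [NumberField F] [IsCMField F] (σ : F →+* ℂ)
  {μ : IdeleClassGroup F →ₜ* Circle} (hμ : IdeleClassGroup.IsConjugateSymplectic F μ)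

/-- Unfolding of `RMuForm`: an inhabitant is a proof that bullet 3 at `θ₂` implies the bullet-4 normalisation at `θ₂`
on every admissible orbit, for all `θ₂`. [cite: Liu2021, Def. 4.5 (2) (TeX ll. 1955–1957)] -/
theorem nonempty_rMuForm_iff (A : AbelianVariety F) (i : IdeleClassGroup.muAlgValueField F μ →+* A.endAlgebra) :
    Nonempty (RMuForm σ hμ A i) ↔
      (letI : Algebra F ℂ := σ.toAlgebra
       haveI := hμ.numberField_muAlgValueField
       ∀ θ₂ : bettiCohomology (A.baseChange ℂ).X 2,
         IsPolarisationClass (IdeleClassGroup.muAlgValueField F μ).subtype A i θ₂ →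
           IsRMuNormalisable (IdeleClassGroup.muAlgValueField F μ).subtype A i θ₂) :=
  ⟨fun ⟨⟨h⟩⟩ => h, fun h => ⟨⟨h⟩⟩⟩

/-- `PolDR σ hμ (RMuForm σ hμ) A i` is inhabited iff `(A, i)` carries a polarisation class with bullet 3 along `σ` AND
bullet 3 implies the bullet-4 normalisation at every such class (`nonempty_polDR_iff` + `nonempty_rMuForm_iff`).
[cite: Liu2021, Def. 4.5 (2) (TeX ll. 1955–1957)] -/
theorem nonempty_polDR_rMuForm_iff (A : AbelianVariety F) (i : IdeleClassGroup.muAlgValueField F μ →+* A.endAlgebra) :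
    Nonempty (PolDR σ hμ (RMuForm σ hμ) A i) ↔
      (letI : Algebra F ℂ := σ.toAlgebra
       haveI := hμ.numberField_muAlgValueField
       (∃ θ₂ : bettiCohomology (A.baseChange ℂ).X 2,
         IsPolarisationClass (IdeleClassGroup.muAlgValueField F μ).subtype A i θ₂) ∧
       ∀ θ₂ : bettiCohomology (A.baseChange ℂ).X 2,
         IsPolarisationClass (IdeleClassGroup.muAlgValueField F μ).subtype A i θ₂ →
           IsRMuNormalisable (IdeleClassGroup.muAlgValueField F μ).subtype A i θ₂) := by
  rw [nonempty_polDR_iff, nonempty_rMuForm_iff]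

end Unfolding

end Literature.NumberTheory.Automorphic.Liu2021.Def45

end
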